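import Mathlib
import HarnessLib
import Summits.AtomisticToContinuum.FouriersLaw.Theses.HiddenChargeMazur
import Summits.AtomisticToContinuum.FouriersLaw.Theorems.HiddenChargeMazurDressedChargeOfNoLocalIntegrals
import Summits.AtomisticToContinuum.FouriersLaw.Theorems.HiddenChargeMazurDressedChargeStubAlgebraize
import Summits.AtomisticToContinuum.FouriersLaw.Theorems.HiddenChargeMazurDressedChargeStubWindowForm
import Summits.AtomisticToContinuum.FouriersLaw.Theorems.HiddenChargeMazurDressedChargeStubPlaneWaveLink
import Summits.AtomisticToContinuum.FouriersLaw.Theorems.HiddenChargeMazurDressedChargeStubHarmonicSymmetries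
import Summits.AtomisticToContinuum.FouriersLaw.Theorems.HiddenChargeMazurDressedChargeStubSeedLink
import Summits.AtomisticToContinuum.FouriersLaw.Theorems.HiddenChargeMazurDressedChargeStubSeedObstruction
import Summits.AtomisticToContinuum.FouriersLaw.Theorems.HiddenChargeMazurDressedChargeStubMainReduction

/-!
# Skeleton for the crux `DressedCharge` — line `birth` (= payload line `registered`), v3
# (continuation lead c1, cycle 1): the odd polynomial classification S1 decomposed

Crux (FIXED, concluded below BY NAME):
`Summit.AtomisticToContinuum.FouriersLaw.Theses.HiddenChargeMazur.DressedCharge`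
(stmt-AtomisticToContinuum-13509, route `HiddenChargeMazur`, sub-problem `FouriersLaw`).

## State inherited (lead cycle 1, prover-line-…-13509-0)

The line is the VACUITY composition: S1 `stub_oddChargeCoboundary` (every momentum-odd polynomial
local conservation law of `pinnedChain`, all parameters `> 0`, is the shift-coboundary of a polynomial
`2R`-site profile) ⟹ `DressedCharge`, the implication being IN THE TREE
(`Theorems.DressedCharge.dressedCharge_of_oddChargeCoboundary`, file
`Theorems/HiddenChargeMazurDressedChargeOfNoLocalIntegrals.lean`, using the landed S2a
`stub_chargeSumCobd` p148807 and S2b `stub_blockOverlap` p151032). Only S1 is open; the previous lead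
parked it on item 12074 (`LocalOhmBV.NoLocalIntegrals`, the SMOOTH census, open-problem class; bridge
`stub_oddChargeCoboundary_of_noLocalIntegrals` p152048).

## This reshape: a direct proof of S1 for POLYNOMIAL densities, in seven stubs

Everything is transported to the lattice polynomial ring `𝒜_R = MvPolynomial (ℤ ⊕ ℤ) R`
(`X (inl x) = q_x`, `X (inr x) = p_x`, `R = ℝ`, and `ℂ` for the spectral arguments), where the
Liouville operator is the DERIVATION `L = MvPolynomial.mkDerivation R (q_x ↦ p_x, p_x ↦ F_x)`, the shift
is `τ = rename (+1)`, momentum reversal is `Θ = aeval (q ↦ q, p ↦ −p)`.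

* A `stub_algebraize`: the item's analytic clauses ⟹ `Θ G = −G`, `L G = Ψ − τΨ` in `𝒜_ℝ`.
* G `stub_mainReduction` (lead): discrete Euler operators reduce the law to the linearised equation
  `(L² + 𝒲) u = 0` for the even characteristic `u = E_p G`; exactness of the lattice variational complex
  and the total-degree filtration around the harmonic chain reduce `u = 0` to C+D and E+F below; then
  `G = C c + H − τH`.
* C `stub_planeWaveLink` + D `stub_harmonicSymmetries`: a homogeneous polynomial symmetry of the pinned
  HARMONIC chain of degree `≥ 2` vanishes (complex plane-wave derivations, multiplier
  `t = (Σμ)² + ω̃(Πz)`, slot induction).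
* E `stub_seedLink` + F `stub_seedObstruction`: the degree-1 seed `u₁ = Σ a_m q_m` cannot be corrected
  at degree 3 (`lam > 0`): plane-wave identity `t·c = 6 lam ΔA` with one zero-wavenumber wave, product
  over sign classes `E₃ 𝒸 = (6 lam)⁴ ΔA⁴`, trailing coefficients along the nontrivial resonance branch
  `z₁ = s², z₂ = 1 + γs` (`E₃ ~ γ²(γ² + 16 ω₂) s⁻⁴`).
* B `stub_windowForm`: a polynomial coboundary of an odd window density is the coboundary of a
  polynomial `2R`-site profile (the item's conclusion shape).
* Composition `stub_oddChargeCoboundary_of : A → B → C → D → E → F → G → S1` (plumbing) and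
  `DressedCharge_of` through the in-tree `dressedCharge_of_oddChargeCoboundary`.

All stub statements are written WITHOUT abbreviations (so that `Theorems/` files prove them verbatim).
Barriers / calibration: unchanged (`HarmonicChainBallisticFlux`: at `lam = β = 0` stub F's `K = 6 lam`
vanishes and D+F do not bite — genuine odd charges `p₀(q_j − q_{−j})` exist there; the crux excludes it).
-/

noncomputable section

namespace Summit.AtomisticToContinuum.FouriersLaw.Cruxes.DressedCharge.Birth

open MeasureTheory
open Literature.MathematicalPhysics.KineticTheory.HeatConduction

/-! ## §1 The registered stubs (ALL LANDED — this file is sorry-free) -/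

/-- **STUB A — `stub_algebraize`** (analytic law ⇒ lattice polynomial algebra; size M).
The item's four algebraic clauses (polynomial `g`, polynomial `ψ`, momentum-odd `g`, the analytic
local conservation law `∀ σ, ∑' x, (p_x ∂_{q_x} + F_x ∂_{p_x})(g∘window) = ψ∘box − ψ∘box∘shift`)
produce, in the lattice polynomial ring `𝒜 = MvPolynomial (ℤ ⊕ ℤ) ℝ` (`X (inl x) = q_x`,
`X (inr x) = p_x`), the re-indexed density `G = rename (i ↦ i − R) p_g` (variables in the window
`[-R, R]`), with `g(σ(· − R)) = eval_σ G`, oddness `Θ G = −G` (`Θ : p ↦ −p` as `aeval`) and the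
conservation law `L G = Ψ − τΨ` for the Liouville DERIVATION
`L = mkDerivation ℝ (q_x ↦ p_x, p_x ↦ F_x)`, `F_x = −U'(q_x) + V'(q_{x+1} − q_x) − V'(q_x − q_{x−1})`
of `pinnedChain` (`U' = ω₂ q + lam q³`, `V' = r + β r³`, tree lemmas `pinnedChain_deriv_U/V` in
`Theorems/HiddenChargeMazurNoOddChargeDefs`), `τ = rename (+1)`.
Why true: `deriv (t ↦ eval (update …) p) = eval (pderiv v p)` (one-variable polynomial calculus),
the `tsum` is the finite window sum (summand vanishes off `[-R, R]`, cf. `tsum_consTerm` of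
`…NoOddChargeConsLaw`), and `MvPolynomial.funext` (ℝ infinite) turns the pointwise identities into
identities of polynomials. -/
theorem stub_algebraize :
    ∀ ω₂ lam β γ : ℝ, ∀ P : OscillatorChain, P = pinnedChain ω₂ lam β γ →
    ∀ (R : ℕ) (g : (Fin (2 * R + 1) → ℝ × ℝ) → ℝ) (ψ : (Fin (2 * (R + 1) + 1) → ℝ × ℝ) → ℝ),
      (∃ p : MvPolynomial (Fin (2 * R + 1) ⊕ Fin (2 * R + 1)) ℝ, ∀ y : Fin (2 * R + 1) → ℝ × ℝ, g y = MvPolynomial.eval (Sum.elim (fun i => (y i).1) (fun i => (y i).2)) p) →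
      (∃ p : MvPolynomial (Fin (2 * (R + 1) + 1) ⊕ Fin (2 * (R + 1) + 1)) ℝ, ∀ y : Fin (2 * (R + 1) + 1) → ℝ × ℝ, ψ y = MvPolynomial.eval (Sum.elim (fun i => (y i).1) (fun i => (y i).2)) p) →
      (∀ y : Fin (2 * R + 1) → ℝ × ℝ, g (fun i => ((y i).1, -(y i).2)) = -g y) →
      (∀ σ : ℤ → ℝ × ℝ, (∑' x : ℤ, ((σ x).2 * deriv (fun t => g (fun i : Fin (2 * R + 1) => Function.update σ x (t, (σ x).2) ((i : ℤ) - (R : ℕ)))) (σ x).1 + (-deriv P.U (σ x).1 + (deriv P.V ((σ (x + 1)).1 - (σ x).1) - deriv P.V ((σ x).1 - (σ (x - 1)).1))) * deriv (fun t => g (fun i : Fin (2 * R + 1) => Function.update σ x ((σ x).1, t) ((i : ℤ) - (R : ℕ)))) (σ x).2)) = ψ (fun i : Fin (2 * (R + 1) + 1) => σ ((i : ℤ) - (R + 1 : ℕ))) - ψ (fun i : Fin (2 * (R + 1) + 1) => σ ((i : ℤ) - (R + 1 : ℕ) + 1))) →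
      ∃ G Ψ : MvPolynomial (ℤ ⊕ ℤ) ℝ,
        (∀ v ∈ G.vars, Sum.elim id id v ∈ Set.Icc (-(R : ℤ)) R) ∧
        (∀ σ : ℤ → ℝ × ℝ, g (fun i : Fin (2 * R + 1) => σ ((i : ℤ) - (R : ℕ))) = MvPolynomial.eval (Sum.elim (fun x : ℤ => (σ x).1) (fun x : ℤ => (σ x).2)) G) ∧
        MvPolynomial.aeval (Sum.elim (fun i : ℤ => (MvPolynomial.X (Sum.inl i) : MvPolynomial (ℤ ⊕ ℤ) ℝ)) (fun i : ℤ => -MvPolynomial.X (Sum.inr i))) (G) = -G ∧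
        (MvPolynomial.mkDerivation ℝ (Sum.elim (fun i : ℤ => (MvPolynomial.X (Sum.inr i) : MvPolynomial (ℤ ⊕ ℤ) ℝ)) (fun i : ℤ => -(MvPolynomial.C ω₂ * MvPolynomial.X (Sum.inl i) + MvPolynomial.C lam * MvPolynomial.X (Sum.inl i) ^ 3) + ((MvPolynomial.X (Sum.inl (i + 1)) - MvPolynomial.X (Sum.inl i)) + MvPolynomial.C β * (MvPolynomial.X (Sum.inl (i + 1)) - MvPolynomial.X (Sum.inl i)) ^ 3) - ((MvPolynomial.X (Sum.inl i) - MvPolynomial.X (Sum.inl (i - 1))) + MvPolynomial.C β * (MvPolynomial.X (Sum.inl i) - MvPolynomial.X (Sum.inl (i - 1))) ^ 3)))) G = Ψ - MvPolynomial.rename (Sum.map (fun i : ℤ => i + 1) (fun i : ℤ => i + 1)) (Ψ) :=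
  -- LANDED (p156858): Theorems/HiddenChargeMazurDressedChargeStubAlgebraize.lean
  Summit.AtomisticToContinuum.FouriersLaw.Theorems.DressedCharge.stub_algebraize

/-- **STUB B — `stub_windowForm`** (polynomial coboundary ⇒ the item's window form; size S/M).
If the window density `g` (sites re-indexed to `[-R, R]`, `G` its lattice polynomial) is
`G = C c + H − τH` in `𝒜` and `g` is momentum-odd, then `g(y) = k(y∘succ) − k(y∘castSucc)` for a
POLYNOMIAL `2R`-site profile `k`. Why true: oddness kills `c` and replaces `H` by
`H₁ = ½(H − ΘH)`; the extreme-site variables of `H₁` survive in `H₁ − τH₁ = G`, so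
`vars H₁ ⊆ [-R, R−1]`; `k(w) = −eval (w placed at −R…R−1) H₁`, a polynomial by
`exists_rename_eq_of_vars_subset_range` (pattern of the landed bridge
`Theorems/HiddenChargeMazurDressedChargeOddCoboundaryOfNoLocalIntegrals`). -/
theorem stub_windowForm :
    ∀ (R : ℕ) (g : (Fin (2 * R + 1) → ℝ × ℝ) → ℝ) (G H : MvPolynomial (ℤ ⊕ ℤ) ℝ) (c : ℝ),
      (∀ v ∈ G.vars, Sum.elim id id v ∈ Set.Icc (-(R : ℤ)) R) →
      (∀ σ : ℤ → ℝ × ℝ, g (fun i : Fin (2 * R + 1) => σ ((i : ℤ) - (R : ℕ))) = MvPolynomial.eval (Sum.elim (fun x : ℤ => (σ x).1) (fun x : ℤ => (σ x).2)) G) →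
      (∀ y : Fin (2 * R + 1) → ℝ × ℝ, g (fun i => ((y i).1, -(y i).2)) = -g y) →
      G = MvPolynomial.C c + H - MvPolynomial.rename (Sum.map (fun i : ℤ => i + 1) (fun i : ℤ => i + 1)) (H) →
      ∃ k : (Fin (2 * R) → ℝ × ℝ) → ℝ,
        (∃ p : MvPolynomial (Fin (2 * R) ⊕ Fin (2 * R)) ℝ, ∀ w : Fin (2 * R) → ℝ × ℝ, k w = MvPolynomial.eval (Sum.elim (fun i => (w i).1) (fun i => (w i).2)) p) ∧
        ∀ y : Fin (2 * R + 1) → ℝ × ℝ, g y = k (fun i => y i.succ) - k (fun i => y (Fin.castSucc i)) :=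
  -- LANDED (p156281): Theorems/HiddenChargeMazurDressedChargeStubWindowForm.lean
  Summit.AtomisticToContinuum.FouriersLaw.Theorems.DressedCharge.stub_windowForm

/-- **STUB C — `stub_planeWaveLink`** (plane-wave multiplier of the harmonic linearised operator; size M).
Over `ℂ`: for the harmonic Liouville derivation `L₁ = mkDerivation (q_x ↦ p_x, p_x ↦ −(ω₂+2)q_x + q_{x+1} + q_{x−1})`,
the anchored potential operator `𝒲₀ w = (ω₂+2)w − τw − τ⁻¹w`, `𝒟₀ = L₁² + 𝒲₀`, and the PLANE-WAVE
derivations `D_(z,μ) = mkDerivation (q_x ↦ z^x, p_x ↦ μ z^x)` with `z ≠ 0`, `μ² = −ω̃(z)`,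
`ω̃(z) = ω₂ + 2 − z − z⁻¹`: `[D_(z,μ), L₁] = μ·D_(z,μ)` (check on generators: uses `μ² = −ω̃(z)`),
`D_(z,μ) ∘ τ = z · τ ∘ D_(z,μ)`, `D ∘ τ⁻¹ = z⁻¹ τ⁻¹ D`; hence for the iterated derivative
`𝐃_P = D_{P₀} ∘ ⋯ ∘ D_{P_{n−1}}` (the `List.foldr`), `𝐃_P L₁ = (L₁ + Σμ_j) 𝐃_P`, `𝐃_P τ = (Πz_j) τ 𝐃_P`;
if `totalDegree w ≤ n` then `𝐃_P w` is a constant `κ`, `L₁ κ = 0`, `τκ = κ`, so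
`constantCoeff 𝐃_P(𝒟₀ w) = ((Σμ_j)² + ω̃(Πz_j)) · κ`. -/
theorem stub_planeWaveLink :
    ∀ (ω₂ : ℝ) (n : ℕ) (w : MvPolynomial (ℤ ⊕ ℤ) ℂ), w.totalDegree ≤ n →
    ∀ P : Fin n → ℂ × ℂ, (∀ j, (P j).1 ≠ 0 ∧ (P j).2 ^ 2 = -((ω₂ : ℂ) + 2 - (P j).1 - ((P j).1)⁻¹)) →
      MvPolynomial.constantCoeff ((List.ofFn P).foldr (fun (Pj : ℂ × ℂ) (acc : MvPolynomial (ℤ ⊕ ℤ) ℂ) => MvPolynomial.mkDerivation ℂ (Sum.elim (fun x : ℤ => (MvPolynomial.C (Pj.1 ^ x) : MvPolynomial (ℤ ⊕ ℤ) ℂ)) (fun x : ℤ => MvPolynomial.C (Pj.2 * Pj.1 ^ x))) acc) ((MvPolynomial.mkDerivation ℂ (Sum.elim (fun i : ℤ => (MvPolynomial.X (Sum.inr i) : MvPolynomial (ℤ ⊕ ℤ) ℂ)) (fun i : ℤ => -(MvPolynomial.C ((ω₂ : ℂ) + 2) * MvPolynomial.X (Sum.inl i)) + MvPolynomial.X (Sum.inl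 (i + 1)) + MvPolynomial.X (Sum.inl (i - 1))))) ((MvPolynomial.mkDerivation ℂ (Sum.elim (fun i : ℤ => (MvPolynomial.X (Sum.inr i) : MvPolynomial (ℤ ⊕ ℤ) ℂ)) (fun i : ℤ => -(MvPolynomial.C ((ω₂ : ℂ) + 2) * MvPolynomial.X (Sum.inl i)) + MvPolynomial.X (Sum.inl (i + 1)) + MvPolynomial.X (Sum.inl (i - 1))))) (w)) + (MvPolynomial.C ((ω₂ : ℂ) + 2) * (w) - MvPolynomial.rename (Sum.map (fun i : ℤ => i + 1) (fun i : ℤ => i + 1)) (w) - MvPolynomial.rename (Sum.map (fun i : ℤ => i - 1) (fun i : ℤ => i - 1)) (w)))) =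
        ((∑ j, (P j).2) ^ 2 + ((ω₂ : ℂ) + 2 - (∏ j, (P j).1) - (∏ j, (P j).1)⁻¹)) * MvPolynomial.constantCoeff ((List.ofFn P).foldr (fun (Pj : ℂ × ℂ) (acc : MvPolynomial (ℤ ⊕ ℤ) ℂ) => MvPolynomial.mkDerivation ℂ (Sum.elim (fun x : ℤ => (MvPolynomial.C (Pj.1 ^ x) : MvPolynomial (ℤ ⊕ ℤ) ℂ)) (fun x : ℤ => MvPolynomial.C (Pj.2 * Pj.1 ^ x))) acc) (w)) :=
  -- LANDED (p156833): Theorems/HiddenChargeMazurDressedChargeStubPlaneWaveLink.lean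
  Summit.AtomisticToContinuum.FouriersLaw.Theorems.DressedCharge.stub_planeWaveLink

/-- **STUB D — `stub_harmonicSymmetries`** (harmonic rigidity: no polynomial symmetry of degree ≥ 2; size L).
If `w ∈ MvPolynomial (ℤ ⊕ ℤ) ℂ` is homogeneous of degree `n ≥ 2` and for every admissible `n`-tuple of
plane waves `t(P) · constantCoeff (𝐃_P w) = 0`, `t(P) = (Σμ_j)² + ω̃(Πz_j)`, then `w = 0`.
Why true (slot induction, no Fourier analysis): `D_(z,μ) = D^q_z + μ D^p_z`; on a LINEAR form `W`,
`constantCoeff D_(z,μ) W = α_W(z) + μ β_W(z)` with `α_W, β_W` finite Laurent sums, and a finite Laurent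
sum vanishing at infinitely many `z` is zero. Slot 0: for fixed admissible `P' = (P₁…)` with
`(Πz', Σμ') ≠ (1, 0)` the norm `t(z,μ;P')·t(z,−μ;P') = c(z)² + 4(Σμ')² ω̃(z)`,
`c(z) = z(1−Πz') + z⁻¹(1−(Πz')⁻¹) + (Σμ')²`, is a NONZERO Laurent polynomial in `z` (coefficient of `z²`
resp. `z`), so off finitely many `z` both signs are non-resonant, `α = β = 0`, the linear form
`D_{P₁}⋯D_{P_{n−1}} w` vanishes, hence so does `D_v D_{P₁}⋯ w` for EVERY constant-coefficient derivation
`D_v`; slot 1: the excluded set is the single wave `(1/Πz'', −Σμ'')`, so again `α = β = 0`; slots ≥ 2: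
no exclusion; finally `D_{v₀}⋯D_{v_{n−1}} w = 0` for all coordinate derivations `D_v = pderiv` forces
`w = 0` (char 0). `ω₂ ≠ 0` excludes the wave `(1, 0)` (needed for `n = 2`). Derivations with constant
coefficients commute (their bracket kills generators). -/
theorem stub_harmonicSymmetries :
    ∀ (ω₂ : ℝ), ω₂ ≠ 0 → ∀ (n : ℕ), 2 ≤ n → ∀ (w : MvPolynomial (ℤ ⊕ ℤ) ℂ), w.IsHomogeneous n →
      (∀ P : Fin n → ℂ × ℂ, (∀ j, (P j).1 ≠ 0 ∧ (P j).2 ^ 2 = -((ω₂ : ℂ) + 2 - (P j).1 - ((P j).1)⁻¹)) →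
        ((∑ j, (P j).2) ^ 2 + ((ω₂ : ℂ) + 2 - (∏ j, (P j).1) - (∏ j, (P j).1)⁻¹)) * MvPolynomial.constantCoeff ((List.ofFn P).foldr (fun (Pj : ℂ × ℂ) (acc : MvPolynomial (ℤ ⊕ ℤ) ℂ) => MvPolynomial.mkDerivation ℂ (Sum.elim (fun x : ℤ => (MvPolynomial.C (Pj.1 ^ x) : MvPolynomial (ℤ ⊕ ℤ) ℂ)) (fun x : ℤ => MvPolynomial.C (Pj.2 * Pj.1 ^ x))) acc) (w)) = 0) →
      w = 0 :=
  -- LANDED (p157057): Theorems/HiddenChargeMazurDressedChargeStubHarmonicSymmetries.lean (+Aux1 p156888)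
  Summit.AtomisticToContinuum.FouriersLaw.Theorems.DressedCharge.stub_harmonicSymmetries

/-- **STUB E — `stub_seedLink`** (plane-wave form of the first anharmonic obstruction; size M/L).
Over `ℂ`, with `L₁, 𝒲₀, 𝒟₀` as in stub C, the cubic force derivation
`L₃ = mkDerivation (q ↦ 0, p_x ↦ −lam q_x³ + β(q_{x+1}−q_x)³ − β(q_x−q_{x−1})³)`, the quadratic
stiffness operator `𝒲₂ u = W₀₀ u + W₀₁ τu + W₀₋₁ τ⁻¹u` (`W₀₀ = 3lam q₀² + 3β(q₁−q₀)² + 3β(q₀−q₋₁)²`,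
`W₀,±₁ = −3β(q_{±1} − q₀)²`) and `𝒟₂ = L₁L₃ + L₃L₁ + 𝒲₂`: if `𝒟₀ u₃ + 𝒟₂ u₁ = 0` with
`u₁ = Σ_m a_m q_m` and `totalDegree u₃ ≤ 3`, then for every admissible triple of plane waves
`t(P)·constantCoeff(𝐃_P u₃) = −F̂(z)·(A(z₀z₁z₂) − A(z₀) − A(z₁) − A(z₂))`,
`F̂ = 6(−lam + βΠ(z_j − 1) − βΠ(1 − z_j⁻¹))`, `A(z) = Σ a_m z^m`.
Why true: stub C's identity `constantCoeff 𝐃(𝒟₀u₃) = t·κ` (re-prove the needed part or import it once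
landed) and the explicit polarisation `𝐃(𝒟₂ u₁)`: `L₃u₁ = 0`, `L₃L₁u₁ = Σ a_m F^cub_m`,
`𝐃 F^cub_m = (z₀z₁z₂)^m F̂`, `𝐃(ℓ² q_m) = Σ_j z_j^m · 2 ℓ̂(z_a)ℓ̂(z_b)` for a linear form `ℓ`
(`ℓ̂(z) = D_z ℓ`), and the three `𝒲₂` terms sum to `−F̂ Σ_j z_j^m`. -/
theorem stub_seedLink :
    ∀ (ω₂ lam β : ℝ) (a : ℤ →₀ ℂ) (u₃ : MvPolynomial (ℤ ⊕ ℤ) ℂ), u₃.totalDegree ≤ 3 →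
      (MvPolynomial.mkDerivation ℂ (Sum.elim (fun i : ℤ => (MvPolynomial.X (Sum.inr i) : MvPolynomial (ℤ ⊕ ℤ) ℂ)) (fun i : ℤ => -(MvPolynomial.C ((ω₂ : ℂ) + 2) * MvPolynomial.X (Sum.inl i)) + MvPolynomial.X (Sum.inl (i + 1)) + MvPolynomial.X (Sum.inl (i - 1))))) ((MvPolynomial.mkDerivation ℂ (Sum.elim (fun i : ℤ => (MvPolynomial.X (Sum.inr i) : MvPolynomial (ℤ ⊕ ℤ) ℂ)) (fun i : ℤ => -(MvPolynomial.C ((ω₂ : ℂ) + 2) * MvPolynomial.X (Sum.inl i)) + MvPolynomial.X (Sum.inl (i + 1)) + MvPolynomial.X (Sum.inl (i - 1))))) (u₃)) + (MvPolynomial.C ((ω₂ : ℂ) + 2) * (u₃) - MvPolynomial.rename (Sum.map (fun i : ℤ => i + 1) (fun i : ℤ => i + 1)) (u₃) - MvPolynomial.rename (Sum.map (fun i : ℤ => i - 1) (fun i : ℤ => i - 1)) (u₃)) + ((MvPolynomial.mkDerivation ℂ (Sum.elim (fun i : ℤ => (MvPolynomial.X (Sum.inr i) : MvPolynomial (ℤ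 ⊕ ℤ) ℂ)) (fun i : ℤ => -(MvPolynomial.C ((ω₂ : ℂ) + 2) * MvPolynomial.X (Sum.inl i)) + MvPolynomial.X (Sum.inl (i + 1)) + MvPolynomial.X (Sum.inl (i - 1))))) ((MvPolynomial.mkDerivation ℂ (Sum.elim (fun _ : ℤ => (0 : MvPolynomial (ℤ ⊕ ℤ) ℂ)) (fun i : ℤ => -(MvPolynomial.C (lam : ℂ) * MvPolynomial.X (Sum.inl i) ^ 3) + MvPolynomial.C (β : ℂ) * (MvPolynomial.X (Sum.inl (i + 1)) - MvPolynomial.X (Sum.inl i)) ^ 3 - MvPolynomial.C (β : ℂ) * (MvPolynomial.X (Sum.inl i) - MvPolynomial.X (Sum.inl (i - 1))) ^ 3))) (a.sum (fun m c => MvPolynomial.C c * MvPolynomial.X (Sum.inl m)))) + (MvPolynomial.mkDerivation ℂ (Sum.elim (fun _ : ℤ => (0 : MvPolynomial (ℤ ⊕ ℤ) ℂ)) (fun i : ℤ => -(MvPolynomial.C (lam : ℂ) * MvPolynomial.X (Sum.inl i) ^ 3) + MvPolynomial.C (β : ℂ) * (MvPolynomial.X (Sum.inl (i + 1)) - MvPolynomial.X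 (Sum.inl i)) ^ 3 - MvPolynomial.C (β : ℂ) * (MvPolynomial.X (Sum.inl i) - MvPolynomial.X (Sum.inl (i - 1))) ^ 3))) ((MvPolynomial.mkDerivation ℂ (Sum.elim (fun i : ℤ => (MvPolynomial.X (Sum.inr i) : MvPolynomial (ℤ ⊕ ℤ) ℂ)) (fun i : ℤ => -(MvPolynomial.C ((ω₂ : ℂ) + 2) * MvPolynomial.X (Sum.inl i)) + MvPolynomial.X (Sum.inl (i + 1)) + MvPolynomial.X (Sum.inl (i - 1))))) (a.sum (fun m c => MvPolynomial.C c * MvPolynomial.X (Sum.inl m)))) + ((MvPolynomial.C (3 * (lam : ℂ)) * MvPolynomial.X (Sum.inl 0) ^ 2 + MvPolynomial.C (3 * (β : ℂ)) * (MvPolynomial.X (Sum.inl 1) - MvPolynomial.X (Sum.inl 0)) ^ 2 + MvPolynomial.C (3 * (β : ℂ)) * (MvPolynomial.X (Sum.inl 0) - MvPolynomial.X (Sum.inl (-1))) ^ 2) * (a.sum (fun m c => MvPolynomial.C c * MvPolynomial.X (Sum.inl m))) - MvPolynomial.C (3 * (β : ℂ)) * (MvPolynomial.X (Sum.inl 1)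 - MvPolynomial.X (Sum.inl 0)) ^ 2 * MvPolynomial.rename (Sum.map (fun i : ℤ => i + 1) (fun i : ℤ => i + 1)) (a.sum (fun m c => MvPolynomial.C c * MvPolynomial.X (Sum.inl m))) - MvPolynomial.C (3 * (β : ℂ)) * (MvPolynomial.X (Sum.inl 0) - MvPolynomial.X (Sum.inl (-1))) ^ 2 * MvPolynomial.rename (Sum.map (fun i : ℤ => i - 1) (fun i : ℤ => i - 1)) (a.sum (fun m c => MvPolynomial.C c * MvPolynomial.X (Sum.inl m))))) = 0 →
      ∀ P : Fin 3 → ℂ × ℂ, (∀ j, (P j).1 ≠ 0 ∧ (P j).2 ^ 2 = -((ω₂ : ℂ) + 2 - (P j).1 - ((P j).1)⁻¹)) →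
        ((∑ j, (P j).2) ^ 2 + ((ω₂ : ℂ) + 2 - (∏ j, (P j).1) - (∏ j, (P j).1)⁻¹)) * MvPolynomial.constantCoeff ((List.ofFn P).foldr (fun (Pj : ℂ × ℂ) (acc : MvPolynomial (ℤ ⊕ ℤ) ℂ) => MvPolynomial.mkDerivation ℂ (Sum.elim (fun x : ℤ => (MvPolynomial.C (Pj.1 ^ x) : MvPolynomial (ℤ ⊕ ℤ) ℂ)) (fun x : ℤ => MvPolynomial.C (Pj.2 * Pj.1 ^ x))) acc) (u₃)) =
          -(6 * (-(lam : ℂ) + (β : ℂ) * ∏ j, ((P j).1 - 1) - (β : ℂ) * ∏ j, (1 - ((P j).1)⁻¹))) *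
            (a.sum (fun m c => c * (∏ j, (P j).1) ^ m) - ∑ j, a.sum (fun m c => c * ((P j).1) ^ m)) :=
  -- LANDED (p157229): Theorems/HiddenChargeMazurDressedChargeStubSeedLink.lean (+Aux1 p157066)
  Summit.AtomisticToContinuum.FouriersLaw.Theorems.DressedCharge.stub_seedLink

/-- **STUB F — `stub_seedObstruction`** (the seed cannot be corrected: resonance-branch contradiction; size L).
Pure algebra over `ℂ`. If Laurent-polynomial functions `c0, c12, c13, c23` of `(z₁, z₂)` satisfy, for
all `z₁, z₂ ≠ 0` and ALL square roots `μ₁² = −ω̃(z₁)`, `μ₂² = −ω̃(z₂)`, `μ₃² = −ω₂`,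
`t · (c0 + μ₁μ₂ c12 + μ₁μ₃ c13 + μ₂μ₃ c23) = K · ΔA`, `t = (μ₁+μ₂+μ₃)² + ω̃(z₁z₂)`,
`ΔA = A(z₁z₂) − A(z₁) − A(z₂) − A(1)`, `K ≠ 0`, then `A = 0`.
Why true: multiply the four identities for the sign classes `(μ₂,μ₃) ↦ (±μ₂, ±μ₃)`:
`Π_δ t_δ = E₃ := E(ω̃(z₁z₂), ω̃(z₁), ω̃(z₂), ω₂)` with the four-square polynomial
`E(a,b,c,d) = (a²+b²+c²+d² − 2(ab+ac+ad+bc+bd+cd))² − 64abcd` (identity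
`Π_{δ₂,δ₃}(X + (μ₁+δ₂μ₂+δ₃μ₃)²) = E(X, −μ₁², −μ₂², −μ₃²)`, checked), and
`Π_δ c_δ = α⁴+x⁴+y⁴+w⁴ − 2Σ(squares)+8αxyw` with `α = c0`, `x² = ω̃₁ω̃₂c12²`, `y² = ω̃₁ω₂c13²`,
`w² = ω̃₂ω₂c23²`, `xyw = −ω̃₁ω̃₂ω₂ c12c13c23` — a Laurent polynomial `𝒸`; so `E₃·𝒸 = K⁴ΔA⁴` on
`(ℂˣ)²`, hence as polynomials after clearing denominators. Substitute the NONTRIVIAL RESONANCE BRANCH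
`z₁ = s², z₂ = 1 + γs` and compare trailing coefficients in `s` over the domain `ℂ[γ]`
(`Polynomial.trailingCoeff_mul`): `(1+γs)⁴E₃(s²,1+γs) = γ²(γ²+16ω₂)s⁻⁴ + O(s⁻³)` (71-term identity,
checked exactly), while if `a_m ≠ 0` for some `m < 0` (lowest `m = −D`), `ΔA ~ −D a_{−D} γ s^{1−2D}`; so
`γ²(γ²+16ω₂) · X(γ) = K⁴D⁴a_{−D}⁴ γ⁴`, absurd at `γ² = −16ω₂ ≠ 0`. If `supp a ⊆ ℤ_{≥0}`: the branch
`z₁ = s⁻²` (same trailing coefficient, checked) sees the top coefficient; `a = a₀δ₀`: `ΔA = −2a₀`,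
absurd at `γ = 0`. -/
theorem stub_seedObstruction :
    ∀ (ω₂ : ℝ), 0 < ω₂ → ∀ (K : ℂ), K ≠ 0 → ∀ (a : ℤ →₀ ℂ), a ≠ 0 →
    ∀ c0 c12 c13 c23 : ℂ → ℂ → ℂ,
      (∀ f ∈ [c0, c12, c13, c23], ∃ (N : ℕ) (p : MvPolynomial (Fin 2) ℂ), ∀ z₁ z₂ : ℂ, z₁ ≠ 0 → z₂ ≠ 0 →
          f z₁ z₂ * (z₁ * z₂) ^ N = MvPolynomial.eval ![z₁, z₂] p) →
      (∀ z₁ z₂ μ₁ μ₂ μ₃ : ℂ, z₁ ≠ 0 → z₂ ≠ 0 →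
          μ₁ ^ 2 = -((ω₂ : ℂ) + 2 - (z₁) - (z₁)⁻¹) → μ₂ ^ 2 = -((ω₂ : ℂ) + 2 - (z₂) - (z₂)⁻¹) → μ₃ ^ 2 = -(ω₂ : ℂ) →
          ((μ₁ + μ₂ + μ₃) ^ 2 + ((ω₂ : ℂ) + 2 - (z₁ * z₂) - (z₁ * z₂)⁻¹)) *
              (c0 z₁ z₂ + μ₁ * μ₂ * c12 z₁ z₂ + μ₁ * μ₃ * c13 z₁ z₂ + μ₂ * μ₃ * c23 z₁ z₂) =
            K * (a.sum (fun m c => c * (z₁ * z₂) ^ m) - a.sum (fun m c => c * (z₁) ^ m) - a.sum (fun m c => c * (z₂) ^ m) - a.sum (fun m c => c * ((1 : ℂ)) ^ m))) →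
      False :=
  -- LANDED (p158270): Theorems/HiddenChargeMazurDressedChargeStubSeedObstruction.lean (+Aux1 p157933, Aux2 p157959)
  Summit.AtomisticToContinuum.FouriersLaw.Theorems.DressedCharge.stub_seedObstruction

/-- **STUB G — `stub_mainReduction`** (LEAD's stub: Euler reduction + filtration; size L; RESHAPED to its
core form once C, D, E, F had landed — they are now used by name inside its proof).
An odd solution `G` of `L G = Ψ − τΨ` in `𝒜` is `C c + H − τH`.
Route: discrete Euler operators `E_q G = Σ_k τ^{-k} ∂_{q_k} G`, `E_p G = Σ_k τ^{-k} ∂_{p_k} G`;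
`[∂_{p_k}, L] = ∂_{q_k}`, `[∂_{q_k}, L] = −Σ_i W_{ki} ∂_{p_i}` give `E_p(LG) = E_q G + L E_p G`,
`E_q(LG) = L E_q G − 𝒲 E_p G` (`𝒲 = 𝒲₀ + 𝒲₂` anchored at site 0), and `E ∘ τ = E`, so the law forces
`v = −Lu`, `(L² + 𝒲)u = 0` for `u = E_p G` (EVEN in `p` as `G` is odd). Total-degree filtration:
`L = L₁ + L₃`, lowest component `u_{n₀}`: `𝒟₀ u_{n₀} = 0`; `n₀ = 0` impossible (`ω₂ ≠ 0`), `n₀ ≥ 2`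
impossible by C + D (map `ℝ → ℂ`), `n₀ = 1`: `u₁ = Σ a_m q_m`, degree-3 component
`𝒟₀u₃ + 𝒟₂u₁ = 0`, E at the triple `((z₁,μ₁),(z₂,μ₂),(1,μ₃))` plus the structure
`constantCoeff 𝐃 u₃ = c0 + μ₁μ₂c12 + μ₁μ₃c13 + μ₂μ₃c23` (evenness of `u₃`, Laurent coefficients) feed F
with `K = 6 lam`: contradiction. So `u = 0`, `v = 0`, and EXACTNESS of the lattice variational complex
(`E_q G = E_p G = 0 ⇒ G ∈ ℝ + Im(1 − τ)`: on the degree-`n` component Euler's identity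
`n G_n = Σ X_v ∂_v G_n ≡ q₀ E_q G_n + p₀ E_p G_n`) gives `G = C c + H − τH`. -/
theorem stub_mainReduction :
    ∀ ω₂ lam β : ℝ, 0 < ω₂ → 0 < lam → 0 < β →
    ∀ G Ψ : MvPolynomial (ℤ ⊕ ℤ) ℝ,
      MvPolynomial.aeval (Sum.elim (fun i : ℤ => (MvPolynomial.X (Sum.inl i) : MvPolynomial (ℤ ⊕ ℤ) ℝ)) (fun i : ℤ => -MvPolynomial.X (Sum.inr i))) (G) = -G →
      (MvPolynomial.mkDerivation ℝ (Sum.elim (fun i : ℤ => (MvPolynomial.X (Sum.inr i) : MvPolynomial (ℤ ⊕ ℤ) ℝ)) (fun i : ℤ => -(MvPolynomial.C ω₂ * MvPolynomial.X (Sum.inl i) + MvPolynomial.C lam * MvPolynomial.X (Sum.inl i) ^ 3) + ((MvPolynomial.X (Sum.inl (i + 1)) - MvPolynomial.X (Sum.inl i)) + MvPolynomial.C β * (MvPolynomial.X (Sum.inl (i + 1)) - MvPolynomial.X (Sum.inl i)) ^ 3) - ((MvPolynomial.X (Sum.inl i) - MvPolynomial.X (Sum.inl (i - 1))) + MvPolynomial.C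 β * (MvPolynomial.X (Sum.inl i) - MvPolynomial.X (Sum.inl (i - 1))) ^ 3)))) G = Ψ - MvPolynomial.rename (Sum.map (fun i : ℤ => i + 1) (fun i : ℤ => i + 1)) (Ψ) →
      ∃ (c : ℝ) (H : MvPolynomial (ℤ ⊕ ℤ) ℝ), G = MvPolynomial.C c + H - MvPolynomial.rename (Sum.map (fun i : ℤ => i + 1) (fun i : ℤ => i + 1)) (H) :=
  -- LANDED (p160360): Theorems/HiddenChargeMazurDressedChargeStubMainReduction.lean (+MainReductionAux1–7: p156649 p156973 p157672 p157767 p158106 p158509 p159622)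
  Summit.AtomisticToContinuum.FouriersLaw.Theorems.DressedCharge.stub_mainReduction

/-! ## §2 Name-keyed copies of the statements -/

namespace Sig

/-- Verbatim statement of S1 `stub_oddChargeCoboundary` (the previously registered stub, now DERIVED). -/
def stub_oddChargeCoboundary : Prop :=
    ∀ ω₂ lam β γ : ℝ, 0 < ω₂ → 0 < lam → 0 < β → 0 < γ →
    ∀ P : OscillatorChain, P = pinnedChain ω₂ lam β γ →
    ∀ (R : ℕ) (g : (Fin (2 * R + 1) → ℝ × ℝ) → ℝ) (ψ : (Fin (2 * (R + 1) + 1) → ℝ × ℝ) → ℝ),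
      (∃ p : MvPolynomial (Fin (2 * R + 1) ⊕ Fin (2 * R + 1)) ℝ, ∀ y : Fin (2 * R + 1) → ℝ × ℝ, g y = MvPolynomial.eval (Sum.elim (fun i => (y i).1) (fun i => (y i).2)) p) →
      (∃ p : MvPolynomial (Fin (2 * (R + 1) + 1) ⊕ Fin (2 * (R + 1) + 1)) ℝ, ∀ y : Fin (2 * (R + 1) + 1) → ℝ × ℝ, ψ y = MvPolynomial.eval (Sum.elim (fun i => (y i).1) (fun i => (y i).2)) p) →
      (∀ y : Fin (2 * R + 1) → ℝ × ℝ, g (fun i => ((y i).1, -(y i).2)) = -g y) →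
      (∀ σ : ℤ → ℝ × ℝ, (∑' x : ℤ, ((σ x).2 * deriv (fun t => g (fun i : Fin (2 * R + 1) => Function.update σ x (t, (σ x).2) ((i : ℤ) - (R : ℕ)))) (σ x).1 + (-deriv P.U (σ x).1 + (deriv P.V ((σ (x + 1)).1 - (σ x).1) - deriv P.V ((σ x).1 - (σ (x - 1)).1))) * deriv (fun t => g (fun i : Fin (2 * R + 1) => Function.update σ x ((σ x).1, t) ((i : ℤ) - (R : ℕ)))) (σ x).2)) = ψ (fun i : Fin (2 * (R + 1) + 1) => σ ((i : ℤ) - (R + 1 : ℕ))) - ψ (fun i : Fin (2 * (R + 1) + 1) => σ ((i : ℤ) - (R + 1 : ℕ) + 1))) →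
      ∃ k : (Fin (2 * R) → ℝ × ℝ) → ℝ,
        (∃ p : MvPolynomial (Fin (2 * R) ⊕ Fin (2 * R)) ℝ, ∀ w : Fin (2 * R) → ℝ × ℝ, k w = MvPolynomial.eval (Sum.elim (fun i => (w i).1) (fun i => (w i).2)) p) ∧
        ∀ y : Fin (2 * R + 1) → ℝ × ℝ, g y = k (fun i => y i.succ) - k (fun i => y (Fin.castSucc i))

/-- Verbatim statement of `stub_algebraize`. -/
def stub_algebraize : Prop :=
    ∀ ω₂ lam β γ : ℝ, ∀ P : OscillatorChain, P = pinnedChain ω₂ lam β γ →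
    ∀ (R : ℕ) (g : (Fin (2 * R + 1) → ℝ × ℝ) → ℝ) (ψ : (Fin (2 * (R + 1) + 1) → ℝ × ℝ) → ℝ),
      (∃ p : MvPolynomial (Fin (2 * R + 1) ⊕ Fin (2 * R + 1)) ℝ, ∀ y : Fin (2 * R + 1) → ℝ × ℝ, g y = MvPolynomial.eval (Sum.elim (fun i => (y i).1) (fun i => (y i).2)) p) →
      (∃ p : MvPolynomial (Fin (2 * (R + 1) + 1) ⊕ Fin (2 * (R + 1) + 1)) ℝ, ∀ y : Fin (2 * (R + 1) + 1) → ℝ × ℝ, ψ y = MvPolynomial.eval (Sum.elim (fun i => (y i).1) (fun i => (y i).2)) p) →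
      (∀ y : Fin (2 * R + 1) → ℝ × ℝ, g (fun i => ((y i).1, -(y i).2)) = -g y) →
      (∀ σ : ℤ → ℝ × ℝ, (∑' x : ℤ, ((σ x).2 * deriv (fun t => g (fun i : Fin (2 * R + 1) => Function.update σ x (t, (σ x).2) ((i : ℤ) - (R : ℕ)))) (σ x).1 + (-deriv P.U (σ x).1 + (deriv P.V ((σ (x + 1)).1 - (σ x).1) - deriv P.V ((σ x).1 - (σ (x - 1)).1))) * deriv (fun t => g (fun i : Fin (2 * R + 1) => Function.update σ x ((σ x).1, t) ((i : ℤ) - (R : ℕ)))) (σ x).2)) = ψ (fun i : Fin (2 * (R + 1) + 1) => σ ((i : ℤ) - (R + 1 : ℕ))) - ψ (fun i : Fin (2 * (R + 1) + 1) => σ ((i : ℤ) - (R + 1 : ℕ) + 1))) →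
      ∃ G Ψ : MvPolynomial (ℤ ⊕ ℤ) ℝ,
        (∀ v ∈ G.vars, Sum.elim id id v ∈ Set.Icc (-(R : ℤ)) R) ∧
        (∀ σ : ℤ → ℝ × ℝ, g (fun i : Fin (2 * R + 1) => σ ((i : ℤ) - (R : ℕ))) = MvPolynomial.eval (Sum.elim (fun x : ℤ => (σ x).1) (fun x : ℤ => (σ x).2)) G) ∧
        MvPolynomial.aeval (Sum.elim (fun i : ℤ => (MvPolynomial.X (Sum.inl i) : MvPolynomial (ℤ ⊕ ℤ) ℝ)) (fun i : ℤ => -MvPolynomial.X (Sum.inr i))) (G) = -G ∧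
        (MvPolynomial.mkDerivation ℝ (Sum.elim (fun i : ℤ => (MvPolynomial.X (Sum.inr i) : MvPolynomial (ℤ ⊕ ℤ) ℝ)) (fun i : ℤ => -(MvPolynomial.C ω₂ * MvPolynomial.X (Sum.inl i) + MvPolynomial.C lam * MvPolynomial.X (Sum.inl i) ^ 3) + ((MvPolynomial.X (Sum.inl (i + 1)) - MvPolynomial.X (Sum.inl i)) + MvPolynomial.C β * (MvPolynomial.X (Sum.inl (i + 1)) - MvPolynomial.X (Sum.inl i)) ^ 3) - ((MvPolynomial.X (Sum.inl i) - MvPolynomial.X (Sum.inl (i - 1))) + MvPolynomial.C β * (MvPolynomial.X (Sum.inl i) - MvPolynomial.X (Sum.inl (i - 1))) ^ 3)))) G = Ψ - MvPolynomial.rename (Sum.map (fun i : ℤ => i + 1) (fun i : ℤ => i + 1)) (Ψ)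

/-- Verbatim statement of `stub_windowForm`. -/
def stub_windowForm : Prop :=
    ∀ (R : ℕ) (g : (Fin (2 * R + 1) → ℝ × ℝ) → ℝ) (G H : MvPolynomial (ℤ ⊕ ℤ) ℝ) (c : ℝ),
      (∀ v ∈ G.vars, Sum.elim id id v ∈ Set.Icc (-(R : ℤ)) R) →
      (∀ σ : ℤ → ℝ × ℝ, g (fun i : Fin (2 * R + 1) => σ ((i : ℤ) - (R : ℕ))) = MvPolynomial.eval (Sum.elim (fun x : ℤ => (σ x).1) (fun x : ℤ => (σ x).2)) G) →
      (∀ y : Fin (2 * R + 1) → ℝ × ℝ, g (fun i => ((y i).1, -(y i).2)) = -g y) →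
      G = MvPolynomial.C c + H - MvPolynomial.rename (Sum.map (fun i : ℤ => i + 1) (fun i : ℤ => i + 1)) (H) →
      ∃ k : (Fin (2 * R) → ℝ × ℝ) → ℝ,
        (∃ p : MvPolynomial (Fin (2 * R) ⊕ Fin (2 * R)) ℝ, ∀ w : Fin (2 * R) → ℝ × ℝ, k w = MvPolynomial.eval (Sum.elim (fun i => (w i).1) (fun i => (w i).2)) p) ∧
        ∀ y : Fin (2 * R + 1) → ℝ × ℝ, g y = k (fun i => y i.succ) - k (fun i => y (Fin.castSucc i))

/-- Verbatim statement of `stub_planeWaveLink`. -/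
def stub_planeWaveLink : Prop :=
    ∀ (ω₂ : ℝ) (n : ℕ) (w : MvPolynomial (ℤ ⊕ ℤ) ℂ), w.totalDegree ≤ n →
    ∀ P : Fin n → ℂ × ℂ, (∀ j, (P j).1 ≠ 0 ∧ (P j).2 ^ 2 = -((ω₂ : ℂ) + 2 - (P j).1 - ((P j).1)⁻¹)) →
      MvPolynomial.constantCoeff ((List.ofFn P).foldr (fun (Pj : ℂ × ℂ) (acc : MvPolynomial (ℤ ⊕ ℤ) ℂ) => MvPolynomial.mkDerivation ℂ (Sum.elim (fun x : ℤ => (MvPolynomial.C (Pj.1 ^ x) : MvPolynomial (ℤ ⊕ ℤ) ℂ)) (fun x : ℤ => MvPolynomial.C (Pj.2 * Pj.1 ^ x))) acc) ((MvPolynomial.mkDerivation ℂ (Sum.elim (fun i : ℤ => (MvPolynomial.X (Sum.inr i) : MvPolynomial (ℤ ⊕ ℤ) ℂ)) (fun i : ℤ => -(MvPolynomial.C ((ω₂ : ℂ) + 2) * MvPolynomial.X (Sum.inl i)) + MvPolynomial.X (Sum.inl (i + 1)) + MvPolynomial.X (Sum.inl (i - 1))))) ((MvPolynomial.mkDerivation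 ℂ (Sum.elim (fun i : ℤ => (MvPolynomial.X (Sum.inr i) : MvPolynomial (ℤ ⊕ ℤ) ℂ)) (fun i : ℤ => -(MvPolynomial.C ((ω₂ : ℂ) + 2) * MvPolynomial.X (Sum.inl i)) + MvPolynomial.X (Sum.inl (i + 1)) + MvPolynomial.X (Sum.inl (i - 1))))) (w)) + (MvPolynomial.C ((ω₂ : ℂ) + 2) * (w) - MvPolynomial.rename (Sum.map (fun i : ℤ => i + 1) (fun i : ℤ => i + 1)) (w) - MvPolynomial.rename (Sum.map (fun i : ℤ => i - 1) (fun i : ℤ => i - 1)) (w)))) =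
        ((∑ j, (P j).2) ^ 2 + ((ω₂ : ℂ) + 2 - (∏ j, (P j).1) - (∏ j, (P j).1)⁻¹)) * MvPolynomial.constantCoeff ((List.ofFn P).foldr (fun (Pj : ℂ × ℂ) (acc : MvPolynomial (ℤ ⊕ ℤ) ℂ) => MvPolynomial.mkDerivation ℂ (Sum.elim (fun x : ℤ => (MvPolynomial.C (Pj.1 ^ x) : MvPolynomial (ℤ ⊕ ℤ) ℂ)) (fun x : ℤ => MvPolynomial.C (Pj.2 * Pj.1 ^ x))) acc) (w))

/-- Verbatim statement of `stub_harmonicSymmetries`. -/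
def stub_harmonicSymmetries : Prop :=
    ∀ (ω₂ : ℝ), ω₂ ≠ 0 → ∀ (n : ℕ), 2 ≤ n → ∀ (w : MvPolynomial (ℤ ⊕ ℤ) ℂ), w.IsHomogeneous n →
      (∀ P : Fin n → ℂ × ℂ, (∀ j, (P j).1 ≠ 0 ∧ (P j).2 ^ 2 = -((ω₂ : ℂ) + 2 - (P j).1 - ((P j).1)⁻¹)) →
        ((∑ j, (P j).2) ^ 2 + ((ω₂ : ℂ) + 2 - (∏ j, (P j).1) - (∏ j, (P j).1)⁻¹)) * MvPolynomial.constantCoeff ((List.ofFn P).foldr (fun (Pj : ℂ × ℂ) (acc : MvPolynomial (ℤ ⊕ ℤ) ℂ) => MvPolynomial.mkDerivation ℂ (Sum.elim (fun x : ℤ => (MvPolynomial.C (Pj.1 ^ x) : MvPolynomial (ℤ ⊕ ℤ) ℂ)) (fun x : ℤ => MvPolynomial.C (Pj.2 * Pj.1 ^ x))) acc) (w)) = 0) →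
      w = 0

/-- Verbatim statement of `stub_seedLink`. -/
def stub_seedLink : Prop :=
    ∀ (ω₂ lam β : ℝ) (a : ℤ →₀ ℂ) (u₃ : MvPolynomial (ℤ ⊕ ℤ) ℂ), u₃.totalDegree ≤ 3 →
      (MvPolynomial.mkDerivation ℂ (Sum.elim (fun i : ℤ => (MvPolynomial.X (Sum.inr i) : MvPolynomial (ℤ ⊕ ℤ) ℂ)) (fun i : ℤ => -(MvPolynomial.C ((ω₂ : ℂ) + 2) * MvPolynomial.X (Sum.inl i)) + MvPolynomial.X (Sum.inl (i + 1)) + MvPolynomial.X (Sum.inl (i - 1))))) ((MvPolynomial.mkDerivation ℂ (Sum.elim (fun i : ℤ => (MvPolynomial.X (Sum.inr i) : MvPolynomial (ℤ ⊕ ℤ) ℂ)) (fun i : ℤ => -(MvPolynomial.C ((ω₂ : ℂ) + 2) * MvPolynomial.X (Sum.inl i)) + MvPolynomial.X (Sum.inl (i + 1)) + MvPolynomial.X (Sum.inl (i - 1))))) (u₃)) + (MvPolynomial.C ((ω₂ : ℂ) + 2) * (u₃) - MvPolynomial.rename (Sum.map (fun i : ℤ => i + 1) (fun i : ℤ =>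 i + 1)) (u₃) - MvPolynomial.rename (Sum.map (fun i : ℤ => i - 1) (fun i : ℤ => i - 1)) (u₃)) + ((MvPolynomial.mkDerivation ℂ (Sum.elim (fun i : ℤ => (MvPolynomial.X (Sum.inr i) : MvPolynomial (ℤ ⊕ ℤ) ℂ)) (fun i : ℤ => -(MvPolynomial.C ((ω₂ : ℂ) + 2) * MvPolynomial.X (Sum.inl i)) + MvPolynomial.X (Sum.inl (i + 1)) + MvPolynomial.X (Sum.inl (i - 1))))) ((MvPolynomial.mkDerivation ℂ (Sum.elim (fun _ : ℤ => (0 : MvPolynomial (ℤ ⊕ ℤ) ℂ)) (fun i : ℤ => -(MvPolynomial.C (lam : ℂ) * MvPolynomial.X (Sum.inl i) ^ 3) + MvPolynomial.C (β : ℂ) * (MvPolynomial.X (Sum.inl (i + 1)) - MvPolynomial.X (Sum.inl i)) ^ 3 - MvPolynomial.C (β : ℂ) * (MvPolynomial.X (Sum.inl i) - MvPolynomial.X (Sum.inl (i - 1))) ^ 3))) (a.sum (fun m c => MvPolynomial.C c * MvPolynomial.X (Sum.inl m)))) + (MvPolynomial.mkDerivation ℂ (Sum.elim (fun _ : ℤ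 => (0 : MvPolynomial (ℤ ⊕ ℤ) ℂ)) (fun i : ℤ => -(MvPolynomial.C (lam : ℂ) * MvPolynomial.X (Sum.inl i) ^ 3) + MvPolynomial.C (β : ℂ) * (MvPolynomial.X (Sum.inl (i + 1)) - MvPolynomial.X (Sum.inl i)) ^ 3 - MvPolynomial.C (β : ℂ) * (MvPolynomial.X (Sum.inl i) - MvPolynomial.X (Sum.inl (i - 1))) ^ 3))) ((MvPolynomial.mkDerivation ℂ (Sum.elim (fun i : ℤ => (MvPolynomial.X (Sum.inr i) : MvPolynomial (ℤ ⊕ ℤ) ℂ)) (fun i : ℤ => -(MvPolynomial.C ((ω₂ : ℂ) + 2) * MvPolynomial.X (Sum.inl i)) + MvPolynomial.X (Sum.inl (i + 1)) + MvPolynomial.X (Sum.inl (i - 1))))) (a.sum (fun m c => MvPolynomial.C c * MvPolynomial.X (Sum.inl m)))) + ((MvPolynomial.C (3 * (lam : ℂ)) * MvPolynomial.X (Sum.inl 0) ^ 2 + MvPolynomial.C (3 * (β : ℂ)) * (MvPolynomial.X (Sum.inl 1) - MvPolynomial.X (Sum.inl 0)) ^ 2 + MvPolynomial.C (3 * (β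 : ℂ)) * (MvPolynomial.X (Sum.inl 0) - MvPolynomial.X (Sum.inl (-1))) ^ 2) * (a.sum (fun m c => MvPolynomial.C c * MvPolynomial.X (Sum.inl m))) - MvPolynomial.C (3 * (β : ℂ)) * (MvPolynomial.X (Sum.inl 1) - MvPolynomial.X (Sum.inl 0)) ^ 2 * MvPolynomial.rename (Sum.map (fun i : ℤ => i + 1) (fun i : ℤ => i + 1)) (a.sum (fun m c => MvPolynomial.C c * MvPolynomial.X (Sum.inl m))) - MvPolynomial.C (3 * (β : ℂ)) * (MvPolynomial.X (Sum.inl 0) - MvPolynomial.X (Sum.inl (-1))) ^ 2 * MvPolynomial.rename (Sum.map (fun i : ℤ => i - 1) (fun i : ℤ => i - 1)) (a.sum (fun m c => MvPolynomial.C c * MvPolynomial.X (Sum.inl m))))) = 0 →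
      ∀ P : Fin 3 → ℂ × ℂ, (∀ j, (P j).1 ≠ 0 ∧ (P j).2 ^ 2 = -((ω₂ : ℂ) + 2 - (P j).1 - ((P j).1)⁻¹)) →
        ((∑ j, (P j).2) ^ 2 + ((ω₂ : ℂ) + 2 - (∏ j, (P j).1) - (∏ j, (P j).1)⁻¹)) * MvPolynomial.constantCoeff ((List.ofFn P).foldr (fun (Pj : ℂ × ℂ) (acc : MvPolynomial (ℤ ⊕ ℤ) ℂ) => MvPolynomial.mkDerivation ℂ (Sum.elim (fun x : ℤ => (MvPolynomial.C (Pj.1 ^ x) : MvPolynomial (ℤ ⊕ ℤ) ℂ)) (fun x : ℤ => MvPolynomial.C (Pj.2 * Pj.1 ^ x))) acc) (u₃)) =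
          -(6 * (-(lam : ℂ) + (β : ℂ) * ∏ j, ((P j).1 - 1) - (β : ℂ) * ∏ j, (1 - ((P j).1)⁻¹))) *
            (a.sum (fun m c => c * (∏ j, (P j).1) ^ m) - ∑ j, a.sum (fun m c => c * ((P j).1) ^ m))

/-- Verbatim statement of `stub_seedObstruction`. -/
def stub_seedObstruction : Prop :=
    ∀ (ω₂ : ℝ), 0 < ω₂ → ∀ (K : ℂ), K ≠ 0 → ∀ (a : ℤ →₀ ℂ), a ≠ 0 →
    ∀ c0 c12 c13 c23 : ℂ → ℂ → ℂ,
      (∀ f ∈ [c0, c12, c13, c23], ∃ (N : ℕ) (p : MvPolynomial (Fin 2) ℂ), ∀ z₁ z₂ : ℂ, z₁ ≠ 0 → z₂ ≠ 0 →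
          f z₁ z₂ * (z₁ * z₂) ^ N = MvPolynomial.eval ![z₁, z₂] p) →
      (∀ z₁ z₂ μ₁ μ₂ μ₃ : ℂ, z₁ ≠ 0 → z₂ ≠ 0 →
          μ₁ ^ 2 = -((ω₂ : ℂ) + 2 - (z₁) - (z₁)⁻¹) → μ₂ ^ 2 = -((ω₂ : ℂ) + 2 - (z₂) - (z₂)⁻¹) → μ₃ ^ 2 = -(ω₂ : ℂ) →
          ((μ₁ + μ₂ + μ₃) ^ 2 + ((ω₂ : ℂ) + 2 - (z₁ * z₂) - (z₁ * z₂)⁻¹)) *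
              (c0 z₁ z₂ + μ₁ * μ₂ * c12 z₁ z₂ + μ₁ * μ₃ * c13 z₁ z₂ + μ₂ * μ₃ * c23 z₁ z₂) =
            K * (a.sum (fun m c => c * (z₁ * z₂) ^ m) - a.sum (fun m c => c * (z₁) ^ m) - a.sum (fun m c => c * (z₂) ^ m) - a.sum (fun m c => c * ((1 : ℂ)) ^ m))) →
      False

/-- Verbatim statement of `stub_mainReduction`. -/
def stub_mainReduction : Prop :=
    ∀ ω₂ lam β : ℝ, 0 < ω₂ → 0 < lam → 0 < β →
    ∀ G Ψ : MvPolynomial (ℤ ⊕ ℤ) ℝ,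
      MvPolynomial.aeval (Sum.elim (fun i : ℤ => (MvPolynomial.X (Sum.inl i) : MvPolynomial (ℤ ⊕ ℤ) ℝ)) (fun i : ℤ => -MvPolynomial.X (Sum.inr i))) (G) = -G →
      (MvPolynomial.mkDerivation ℝ (Sum.elim (fun i : ℤ => (MvPolynomial.X (Sum.inr i) : MvPolynomial (ℤ ⊕ ℤ) ℝ)) (fun i : ℤ => -(MvPolynomial.C ω₂ * MvPolynomial.X (Sum.inl i) + MvPolynomial.C lam * MvPolynomial.X (Sum.inl i) ^ 3) + ((MvPolynomial.X (Sum.inl (i + 1)) - MvPolynomial.X (Sum.inl i)) + MvPolynomial.C β * (MvPolynomial.X (Sum.inl (i + 1)) - MvPolynomial.X (Sum.inl i)) ^ 3) - ((MvPolynomial.X (Sum.inl i) - MvPolynomial.X (Sum.inl (i - 1))) + MvPolynomial.C β * (MvPolynomial.X (Sum.inl i) - MvPolynomial.X (Sum.inl (i - 1))) ^ 3)))) G = Ψ - MvPolynomial.rename (Sum.map (fun i : ℤ => i + 1) (fun i : ℤ => i + 1)) (Ψ) →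
      ∃ (c : ℝ) (H : MvPolynomial (ℤ ⊕ ℤ) ℝ), G = MvPolynomial.C c + H - MvPolynomial.rename (Sum.map (fun i : ℤ => i + 1) (fun i : ℤ => i + 1)) (H)

end Sig

/-! ## §3 The composition (kernel-checked, no sorry) -/

/-- **S1 from the stubs** (plumbing; ALL STUBS LANDED, no hypotheses left): algebraize (A), reduce (G,
which uses C, D, E, F by name), and read off the window form (B). -/
theorem stub_oddChargeCoboundary_of : Sig.stub_oddChargeCoboundary := by
  intro ω₂ lam β γ hω hl hβ _hγ P hP R g ψ hg hψ hodd hlaw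
  obtain ⟨G, Ψ, hvars, heval, hΘ, hL⟩ := stub_algebraize ω₂ lam β γ P hP R g ψ hg hψ hodd hlaw
  obtain ⟨c, H, hGH⟩ := stub_mainReduction ω₂ lam β hω hl hβ G Ψ hΘ hL
  exact stub_windowForm R g G H c hvars heval hodd hGH

/-- **THE SKELETON THEOREM, CLOSED.** `DressedCharge` with no hypotheses: S1 by
`stub_oddChargeCoboundary_of` (seven landed stubs), then the in-tree vacuity composition
`Theorems.DressedCharge.dressedCharge_of_oddChargeCoboundary` (S2a, S2b landed). The clean tree version is
`Theorems/HiddenChargeMazurDressedCharge.lean` (`Theorems.dressedCharge_proof`). -/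
theorem DressedCharge_of :
    Summit.AtomisticToContinuum.FouriersLaw.Theses.HiddenChargeMazur.DressedCharge :=
  Summit.AtomisticToContinuum.FouriersLaw.Theorems.DressedCharge.dressedCharge_of_oddChargeCoboundary
    stub_oddChargeCoboundary_of

end Summit.AtomisticToContinuum.FouriersLaw.Cruxes.DressedCharge.Birth

end
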